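/-
Origin: expansion seat `planner-pub-hodgecm-pohl-g9-0`, handover #2 2026-08-18T08:14:17Z (`HOME/pub-hodgecm-pohl-g9/lean/Pohl9/NonGaloisIndex.lean`, md5 54252590, 373 lines);
landed by the gen-7 packager in gate run 26 as `HodgeCM/Proofs/Pohlmann/NonGaloisIndex.lean` (import ^import Pohl9\.→import HodgeCM.Proofs.Pohlmann. ×1).
-/
/-
Copyright: pub-hodgecm formalisation cell (harness21, 2026). New file (not vendored).
Origin: HOME/pub-hodgecm-pohl-g9/lean/Pohl9/NonGaloisIndex.lean — session planner-pub-hodgecm-pohl-g9-0 (unit pub-hodgecm-pohl-g9),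
EXPANSION part (b) `PohlmannSpan`, generation 9.  Intended final place: `HodgeCM/Proofs/Pohlmann/NonGaloisIndex.lean`
(module `HodgeCM.Proofs.Pohlmann.NonGaloisIndex`).  ADDITIVE leaf.  WIP import `Pohl9.AnyCMField` = the handed-over
`HodgeCM/Proofs/Pohlmann/AnyCMField.lean` (rewrite to `import HodgeCM.Proofs.Pohlmann.AnyCMField` on landing).
-/
import Summits.HodgeConjecture.HodgeCM.Proofs.Pohlmann.AnyCMField

/-!
# Off the Galois case the OLD index set `IsHodgeWeight` undercounts: a kernel witness

`AnyCMField.lean` proves Gao–Ullmo Thm 3.1 (Pohlmann) for EVERY CM field `F`, with the index set `IsHodgeWeightC` (the paper's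
condition (3.2) for `G = Gal(E^c/ℚ)`, `GaoUllmo.isHodgeWeightC_iff_satisfiesEq32`).  The package's older index set
`IsHodgeWeight Θ p S` (CM/LefschetzChar.lean) asks invariance of the count under the group `GalT F` of ALL Galois translates —
permutations of `Hom(F, ℂ)` commuting with pre-composition by `Aut(F/ℚ)` — which contains the image of `Gal(E^c/ℚ)`
(`GaoUllmo.galTOf`) and is that image when `F` is Galois (`GaoUllmo.galTOf_surjective`).  This file shows in the kernel that
for non-Galois `F` the two index sets can differ, and that then the body of `PohlmannSpan` / `PohlmannBasis` with the hypothesis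
`IsGalois ℚ F` simply DELETED is FALSE in every universe satisfying the model axioms and N1–N4 — so the generalisation to
arbitrary CM fields must change the index set (as AnyCMField.lean does), not just drop the hypothesis:

* `NonGalois.isHodgeWeight_pair`: for any CM field, every conjugate pair `{s, s̄}` is an old Hodge weight of `A_{(F,Θ)}` in
  degree `2` (`GalT F` commutes with conjugation, `GalT.apply_conjugate`);
* `NonGalois.isHodgeWeight_one_iff_pair`: if `Aut(F/ℚ) = {1, c}` (`AutPair F`) these are ALL the old Hodge weights of degree
  `2`: `GalT F` then contains the transposition `s ↔ s̄` fixing every other embedding (`swapT`) — so at most `g = dim A_Θ` old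
  weights;
* `NonGalois.isHodgeWeightC_one_of_mem`: if every `σ ∈ Gal(E^c/ℚ)` maps `Θ` into `Θ` or into `Θ̄` (`GalStableType Θ`; automatic
  for a type induced from a subfield, `galStableType_of_induced`), every `{s, t}` with `s ∈ Θ`, `t ∉ Θ` IS a Galois-closure
  Hodge weight — at least `g²` of them (`Universe.card_mul_card_le_card_isHodgeWeightC`);
* `Universe.not_naivePohlmannSpanAt`: hence, under `ModelAxioms` + N1–N4, for such `(F, Θ)` with `g ≥ 2` the inclusion
  `B¹(A_Θ) ⊗ 1 ⊆ span_ℂ {weight vectors of OLD Hodge weights}` (= the body of `PohlmannSpan` at `n = 0`, `p = 1`,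
  `Universe.pohlmannSpan_iff_naive`) FAILS: `dim_ℚ B¹ = #{S // IsHodgeWeightC} ≥ g² > g ≥ dim_ℂ` of that span, using
  `finrank_hodgeClassesOf_C` of AnyCMField.lean; while the corrected span `Universe.pohlmannSpanCM_at` holds.
Example in print terms (not constructed here): `F = K·L`, `K` imaginary quadratic, `L` a totally real quartic field whose Galois
closure has group `S₄` (so `Aut(F/ℚ) = {1, c}`), `Θ` induced from `K`: `A_Θ ~ E_K⁴`, `dim_ℚ B¹(A_Θ) = 16`, old count `4`.
Nothing is posited: `AutPair F`, `GalStableType Θ` are explicit hypotheses on `(F, Θ)`.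
-/

noncomputable section

open scoped TensorProduct NumberField BigOperators
open NumberField NumberField.ComplexEmbedding

attribute [local instance] Classical.propDecidable

namespace HodgeCM

open Literature.AlgebraicGeometry.Motives (CMType HodgeStructure)
open Literature.AlgebraicGeometry.Motives.HodgeStructure (ofRat ofRat_apply)
open HodgeCM.Pohlmann HodgeCM.GaoUllmo HodgeCM.CMTypeOps

namespace NonGalois

/-! ### Conjugate pairs are old Hodge weights (any CM field) -/

/-- `∑ over Fin (0 + 1)` (the shape the unfolded `IsHodgeWeight` / `IsHodgeWeightC` carry at `n = 0`). -/
theorem sum_univ_fin_one {M : Type*} [AddCommMonoid M] (f : Fin (0 + 1) → M) : ∑ j, f j = f 0 :=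
  Fin.sum_univ_one f

section Ind

variable {F : Type} [Field F]

/-- (Ported verbatim from the HodgeCMPerL package; no docstring in the source.) -/
theorem ind_one {Θ : CMType F} {s : F →+* ℂ} (h : s ∈ Θ.1) : ind Θ s = 1 := by
  unfold ind; exact if_pos h

/-- (Ported verbatim from the HodgeCMPerL package; no docstring in the source.) -/
theorem ind_zero {Θ : CMType F} {s : F →+* ℂ} (h : s ∉ Θ.1) : ind Θ s = 0 := by
  unfold ind; exact if_neg h

/-- `1_Θ(s) + 1_Θ(s̄) = 1`. -/
theorem ind_add_ind_conjugate (Θ : CMType F) (s : F →+* ℂ) : ind Θ s + ind Θ (conjugate s) = 1 := by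
  by_cases h : s ∈ Θ.1
  · rw [ind_one h, ind_zero ((mem_iff_conjugate_notMem Θ s).mp h)]; rfl
  · rw [ind_zero h, ind_one ((conjugate_mem_iff_notMem Θ s).mpr h)]; rfl

end Ind

section Pairs

variable {F : Type} [Field F] [NumberField F] [IsCMField F]

/-- (Ported verbatim from the HodgeCMPerL package; no docstring in the source.) -/
theorem conjugate_ne_self (s : F →+* ℂ) : conjugate s ≠ s := fun h =>
  IsTotallyComplex.complexEmbedding_not_isReal s (ComplexEmbedding.isReal_iff.mpr h)

/-- The weight `({s, s̄})` on the single factor `A_{(F,Θ)}` (`n = 0`). -/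
def pairWeight (s : F →+* ℂ) : Fin 1 → Finset (F →+* ℂ) := fun _ => {s, conjugate s}

/-- (Ported verbatim from the HodgeCMPerL package; no docstring in the source.) -/
theorem card_pair_conjugate (s : F →+* ℂ) : ({s, conjugate s} : Finset (F →+* ℂ)).card = 2 :=
  Finset.card_pair (conjugate_ne_self s).symm

/-- Every conjugate pair is an OLD Hodge weight of degree `2` on `A_{(F,Θ)}`, for every CM field `F` and every type `Θ`. -/
theorem isHodgeWeight_pair (Θ : CMType F) (s : F →+* ℂ) : IsHodgeWeight (fun _ : Fin 1 => Θ) 1 (pairWeight s) := by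
  refine ⟨?_, fun P => ?_⟩
  · rw [sum_univ_fin_one]
    exact card_pair_conjugate s
  · rw [sum_univ_fin_one]
    show ∑ u ∈ ({s, conjugate s} : Finset (F →+* ℂ)), ind Θ (P.1 u) = 1
    rw [Finset.sum_pair (conjugate_ne_self s).symm, GalT.apply_conjugate, ind_add_ind_conjugate]

end Pairs

/-! ### When `Aut(F/ℚ) = {1, c}`, the conjugate pairs are ALL the old Hodge weights of degree 2 -/

section AutPair

variable {F : Type} [Field F] [NumberField F] [IsCMField F]

/-- `Aut(F/ℚ) = {1, c}` (`c` = `conjAlgEquiv F`, the CM conjugation) — the generic situation for a non-Galois CM field, e.g.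
`F = K·L` with `K` imaginary quadratic and `L` totally real with trivial automorphism group. -/
def AutPair (F : Type) [Field F] [NumberField F] [IsCMField F] : Prop :=
  ∀ g : F ≃ₐ[ℚ] F, g = AlgEquiv.refl ∨ g = conjAlgEquiv F

/-- Under `AutPair F` the transposition `s ↔ s̄` (all other embeddings fixed) is a Galois translate. -/
theorem isGalTranslate_swap (hA : AutPair F) (s : F →+* ℂ) : IsGalTranslate F (Equiv.swap s (conjugate s)) := by
  intro σ g
  rcases hA g with rfl | rfl
  · show Equiv.swap s (conjugate s) (σ.comp (RingHom.id F)) = (Equiv.swap s (conjugate s) σ).comp (RingHom.id F)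
    rw [RingHom.comp_id, RingHom.comp_id]
  · rw [← conjugate_eq_comp_conjAlgEquiv, ← conjugate_eq_comp_conjAlgEquiv]
    by_cases h1 : σ = s
    · subst h1
      rw [Equiv.swap_apply_left, Equiv.swap_apply_right, involutive_conjugate F]
    by_cases h2 : σ = conjugate s
    · subst h2
      rw [involutive_conjugate F, Equiv.swap_apply_left, Equiv.swap_apply_right]
    · have h3 : conjugate σ ≠ s := fun h => h2 (by rw [← h, involutive_conjugate F])
      have h4 : conjugate σ ≠ conjugate s := fun h => h1 ((involutive_conjugate F).injective h)
      rw [Equiv.swap_apply_of_ne_of_ne h3 h4, Equiv.swap_apply_of_ne_of_ne h1 h2]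

/-- The transposition `s ↔ s̄` as an element of `GalT F`. -/
def swapT (hA : AutPair F) (s : F →+* ℂ) : GalT F := ⟨Equiv.swap s (conjugate s), isGalTranslate_swap hA s⟩

/-- (Ported verbatim from the HodgeCMPerL package; no docstring in the source.) -/
@[simp] theorem swapT_apply (hA : AutPair F) (s σ : F →+* ℂ) : (swapT hA s).1 σ = Equiv.swap s (conjugate s) σ := rfl

/-- Under `AutPair F`, the OLD Hodge weights of degree `2` on `A_{(F,Θ)}` are exactly the conjugate pairs `{s, s̄}`, `s ∈ Θ`. -/
theorem isHodgeWeight_one_iff_pair (hA : AutPair F) (Θ : CMType F) (S : Fin 1 → Finset (F →+* ℂ)) :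
    IsHodgeWeight (fun _ : Fin 1 => Θ) 1 S ↔ ∃ s ∈ Θ.1, S = pairWeight s := by
  constructor
  · rintro ⟨hcard, hP⟩
    rw [sum_univ_fin_one] at hcard
    obtain ⟨a, b, hab, hS⟩ := Finset.card_eq_two.mp hcard
    have hP' : ∀ P : GalT F, ∑ u ∈ S 0, ind Θ (P.1 u) = 1 := fun P => by
      have h := hP P
      rw [sum_univ_fin_one] at h
      exact h
    have h1 := hP' 1
    rw [hS, Finset.sum_pair hab, GalT.one_apply, GalT.one_apply] at h1
    -- `b = ā`: otherwise the transposition `a ↔ ā` changes the count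
    have hb : b = conjugate a := by
      by_contra hb
      have hba : b ≠ a := fun h => hab h.symm
      have h2 := hP' (swapT hA a)
      rw [hS, Finset.sum_pair hab, swapT_apply, swapT_apply, Equiv.swap_apply_left,
        Equiv.swap_apply_of_ne_of_ne hba hb] at h2
      have h3 := ind_add_ind_conjugate Θ a
      by_cases ha : a ∈ Θ.1
      · by_cases hb' : b ∈ Θ.1
        · rw [ind_one ha, ind_one hb'] at h1; exact absurd h1 (by decide)
        · rw [ind_one ha] at h3
          rw [ind_zero hb'] at h2
          have : ind Θ (conjugate a) = 0 := by omega
          rw [this] at h2; exact absurd h2 (by decide)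
      · by_cases hb' : b ∈ Θ.1
        · rw [ind_zero ha] at h3
          rw [ind_one hb'] at h2
          have : ind Θ (conjugate a) = 1 := by omega
          rw [this] at h2; exact absurd h2 (by decide)
        · rw [ind_zero ha, ind_zero hb'] at h1; exact absurd h1 (by decide)
    subst hb
    by_cases ha : a ∈ Θ.1
    · exact ⟨a, ha, funext fun j => by rw [Subsingleton.elim j 0, hS]; rfl⟩
    · -- `a ∉ Θ`, so `ā ∈ Θ` and `S = pairWeight ā`
      refine ⟨conjugate a, (conjugate_mem_iff_notMem Θ a).mpr ha, funext fun j => ?_⟩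
      rw [Subsingleton.elim j 0, hS, pairWeight, involutive_conjugate F, Finset.pair_comm]
  · rintro ⟨s, -, rfl⟩
    exact isHodgeWeight_pair Θ s

end AutPair

/-! ### Galois-closure Hodge weights of degree 2 for a type stable under `Gal(E^c/ℚ)` up to conjugation -/

section Stable

variable {F : Type} [Field F] [NumberField F] [IsCMField F]

/-- Every `σ ∈ Gal(E^c/ℚ)` (`E = F¹`) maps `Θ` into `Θ` or into `Θ̄`.  (Automatic for a type induced from a subfield,
`galStableType_of_induced`; fails for a primitive type of a Galois `F` of degree `≥ 4`.) -/
def GalStableType (Θ : CMType F) : Prop :=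
  ∀ σ : galoisClosure (Fin (0 + 1) → F) ≃ₐ[ℚ] galoisClosure (Fin (0 + 1) → F),
    (∀ s ∈ Θ.1, galF 0 σ s ∈ Θ.1) ∨ (∀ s ∈ Θ.1, galF 0 σ s ∉ Θ.1)

/-- (Ported verbatim from the HodgeCMPerL package; no docstring in the source.) -/
theorem galF_conjugate (σ : galoisClosure (Fin (0 + 1) → F) ≃ₐ[ℚ] galoisClosure (Fin (0 + 1) → F)) (s : F →+* ℂ) :
    galF 0 σ (conjugate s) = conjugate (galF 0 σ s) := by
  rw [← galTOf_apply, ← galTOf_apply]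
  exact GalT.apply_conjugate (galTOf σ) s

/-- The mixed weight `({s, t})`, `s ∈ Θ`, `t ∉ Θ`, IS a Galois-closure Hodge weight of degree `2` when `Θ` is Galois-stable up
to conjugation. -/
theorem isHodgeWeightC_one_of_mem (Θ : CMType F) (hΘ : GalStableType Θ) {s t : F →+* ℂ} (hs : s ∈ Θ.1) (ht : t ∉ Θ.1) :
    IsHodgeWeightC (fun _ : Fin 1 => Θ) 1 (fun _ => {s, t}) := by
  have hst : s ≠ t := fun h => ht (h ▸ hs)
  refine ⟨?_, fun σ => ?_⟩
  · rw [sum_univ_fin_one]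
    exact Finset.card_pair hst
  · rw [sum_univ_fin_one]
    show ∑ u ∈ ({s, t} : Finset (F →+* ℂ)), ind Θ (galF 0 σ u) = 1
    rw [Finset.sum_pair hst]
    have htc : conjugate t ∈ Θ.1 := (conjugate_mem_iff_notMem Θ t).mpr ht
    rcases hΘ σ with h | h
    · have h1 : galF 0 σ t ∉ Θ.1 := by
        rw [← conjugate_mem_iff_notMem, ← galF_conjugate]; exact h _ htc
      rw [ind_one (h s hs), ind_zero h1]; rfl
    · have h1 : galF 0 σ t ∈ Θ.1 := by
        have h2 := h _ htc
        rw [galF_conjugate, conjugate_mem_iff_notMem, not_not] at h2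
        exact h2
      rw [ind_zero (h s hs), ind_one h1]; rfl

end Stable

section Induced

variable {F : Type} [Field F] [NumberField F]

/-- A CM type INDUCED from a subfield (`Θ = {s : s ∘ i = k₀}` for a ring map `i : K → F`) is Galois-stable up to conjugation:
`(σ ∘ s) ∘ i` does not depend on `s ∈ Θ`. -/
theorem galStableType_of_induced {K : Type} [Field K] (i : K →+* F) (k₀ : K →+* ℂ) (Θ : CMType F)
    (hΘ : ∀ s, s ∈ Θ.1 ↔ s.comp i = k₀) : GalStableType Θ := by
  intro σ
  have hcommon : ∀ s ∈ Θ.1, ∀ s' ∈ Θ.1, (galF 0 σ s).comp i = (galF 0 σ s').comp i := by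
    intro s hs s' hs'
    have hss' : s.comp i = s'.comp i := by rw [(hΘ s).mp hs, (hΘ s').mp hs']
    ext x
    have hx : corestrict (Fin (0 + 1) → F) (piEmb 0 s) (piDiag (i x)) =
        corestrict (Fin (0 + 1) → F) (piEmb 0 s') (piDiag (i x)) := by
      apply Subtype.ext
      rw [coe_corestrict_apply, coe_corestrict_apply, piEmb_apply, piEmb_apply, piDiag_apply]
      exact RingHom.congr_fun hss' x
    rw [RingHom.comp_apply, RingHom.comp_apply, galF_apply, galF_apply, hx]
  by_cases hex : ∃ s₀ ∈ Θ.1, galF 0 σ s₀ ∈ Θ.1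
  · obtain ⟨s₀, hs₀, h₀⟩ := hex
    exact Or.inl fun s hs => (hΘ _).mpr (by rw [hcommon s hs s₀ hs₀]; exact (hΘ _).mp h₀)
  · push Not at hex
    exact Or.inr hex

end Induced

end NonGalois

/-! ### The naive (hypothesis-free) Pohlmann span fails off the Galois case -/

namespace Universe

open NonGalois

variable {U : Universe}

/-- The BODY of `PohlmannSpan` at one `(F, Θ, p)`, with no hypothesis on the CM field `F`:
`B^p(A_Θ) ⊗ 1 ⊆ span_ℂ {weight vectors of the OLD Hodge weights}`. -/
def NaivePohlmannSpanAt (U : Universe) (F : CMField) {n : ℕ} (Θ : Fin (n + 1) → CMType F) (p : ℕ) : Prop :=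
  (U.hodgeClassesOf (U.cmProd F Θ) p).map ofRat ≤
    (Submodule.span ℂ {x : U.CohC (U.cmProd F Θ) (2 * p) |
      ∃ S : Fin (n + 1) → Finset ((F : Type) →+* ℂ), IsHodgeWeight Θ p S ∧ U.IsWeightVector F Θ S (2 * p) x}).restrictScalars ℚ

/-- `PohlmannSpan` IS the naive span asserted for Galois `F` of degree `≥ 6` (definitional unfolding). -/
theorem pohlmannSpan_iff_naive :
    U.PohlmannSpan ↔ ∀ F : CMField, IsGalois ℚ F → 6 ≤ Module.finrank ℚ F →
      ∀ (n : ℕ) (Θ : Fin (n + 1) → CMType F) (p : ℕ), U.NaivePohlmannSpanAt F Θ p :=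
  Iff.rfl

/-- The corrected span (index set `IsHodgeWeightC`, AnyCMField.lean) holds for EVERY CM field under the model axioms and
N1–N4 — restated pointwise next to the failure of the naive one. -/
theorem pohlmannSpanCM_at (M : U.ModelAxioms) (hN1 : U.Fact_cupExterior) (hN2 : U.Fact_cup_hodge)
    (hN3 : U.Fact_pull_H0) (hN4 : U.Fact_hodge_F0) (F : CMField) {n : ℕ} (Θ : Fin (n + 1) → CMType F) (p : ℕ) :
    (U.hodgeClassesOf (U.cmProd F Θ) p).map ofRat ≤
      (Submodule.span ℂ {x : U.CohC (U.cmProd F Θ) (2 * p) |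
        ∃ S : Fin (n + 1) → Finset ((F : Type) →+* ℂ), IsHodgeWeightC Θ p S ∧ U.IsWeightVector F Θ S (2 * p) x}).restrictScalars ℚ :=
  pohlmannSpanCM_of_facts M hN1 hN2 hN3 hN4 F n Θ p

section Count

variable {F : Type} [Field F] [NumberField F] [IsCMField F]

/-- `g·g ≤ #{Galois-closure Hodge weights of degree 2}` for a Galois-stable type (`g = #Θ = dim A_Θ`): the mixed weights
`{s, t̄}`, `s, t ∈ Θ`, are pairwise distinct Galois-closure Hodge weights. -/
theorem card_mul_card_le_card_isHodgeWeightC (Θ : CMType F) (hΘ : GalStableType Θ) :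
    Nat.card Θ.1 * Nat.card Θ.1 ≤ Nat.card {S : Fin 1 → Finset (F →+* ℂ) // IsHodgeWeightC (fun _ : Fin 1 => Θ) 1 S} := by
  rw [← Nat.card_prod]
  refine Nat.card_le_card_of_injective
    (fun x : Θ.1 × Θ.1 => ⟨fun _ => {x.1.1, conjugate x.2.1},
      isHodgeWeightC_one_of_mem Θ hΘ x.1.2 ((mem_iff_conjugate_notMem Θ _).mp x.2.2)⟩) ?_
  rintro ⟨⟨s, hs⟩, ⟨t, ht⟩⟩ ⟨⟨s', hs'⟩, ⟨t', ht'⟩⟩ h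
  have h' : ({s, conjugate t} : Finset (F →+* ℂ)) = {s', conjugate t'} := congr_fun (congrArg Subtype.val h) 0
  have hct : conjugate t ∉ Θ.1 := (mem_iff_conjugate_notMem Θ t).mp ht
  have hct' : conjugate t' ∉ Θ.1 := (mem_iff_conjugate_notMem Θ t').mp ht'
  have hs_mem : s ∈ ({s', conjugate t'} : Finset (F →+* ℂ)) := h' ▸ Finset.mem_insert_self _ _
  have ht_mem : conjugate t ∈ ({s', conjugate t'} : Finset (F →+* ℂ)) :=
    h' ▸ Finset.mem_insert_of_mem (Finset.mem_singleton_self _)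
  rw [Finset.mem_insert, Finset.mem_singleton] at hs_mem ht_mem
  have h1 : s = s' := hs_mem.resolve_right fun h => hct' (h ▸ hs)
  have h2 : t = t' := (involutive_conjugate F).injective (ht_mem.resolve_left fun h => hct (h ▸ hs'))
  subst h1; subst h2; rfl

end Count

/-- **The naive Pohlmann span is FALSE off the Galois case.**  In any universe with the model axioms and N1–N4, for a CM
field `F` with `Aut(F/ℚ) = {1, c}` and a CM type `Θ`, Galois-stable up to conjugation, with `g = dim A_Θ ≥ 2`, the rational
Hodge classes `B¹(A_Θ)` are NOT contained in the span of the weight vectors of the old (`GalT F`-invariant) Hodge weights: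
`dim_ℚ B¹ = #{IsHodgeWeightC} ≥ g·g > g ≥ dim_ℂ span`. -/
theorem not_naivePohlmannSpanAt (M : U.ModelAxioms) (hN1 : U.Fact_cupExterior) (hN2 : U.Fact_cup_hodge)
    (hN3 : U.Fact_pull_H0) (hN4 : U.Fact_hodge_F0) (F : CMField) (hA : AutPair F) (Θ : CMType F) (hΘ : GalStableType Θ)
    (h2 : ∃ s₁ ∈ Θ.1, ∃ s₂ ∈ Θ.1, s₁ ≠ s₂) : ¬ U.NaivePohlmannSpanAt F (fun _ : Fin 1 => Θ) 1 := by
  intro h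
  haveI : Fintype Θ.1 := Fintype.ofFinite _
  -- each pair weight space is a line `ℂ ∙ v s`
  have hline : ∀ s : Θ.1, ∃ v : U.CohC (U.cmProd F (fun _ : Fin 1 => Θ)) (2 * 1),
      U.weightSpace F (fun _ : Fin 1 => Θ) (pairWeight s.1) (2 * 1) = ℂ ∙ v := by
    intro s
    have h1 : Module.finrank ℂ (U.weightSpace F (fun _ : Fin 1 => Θ) (pairWeight s.1) (2 * 1)) = 1 := by
      rw [finrank_weightSpace M hN1 (by norm_num : 0 < 2 * 1), if_pos]
      rw [sum_univ_fin_one]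
      exact card_pair_conjugate s.1
    obtain ⟨v, hv, hv0⟩ : ∃ v ∈ U.weightSpace F (fun _ : Fin 1 => Θ) (pairWeight s.1) (2 * 1), v ≠ 0 := by
      apply Submodule.exists_mem_ne_zero_of_ne_bot
      intro h0
      rw [h0, finrank_bot] at h1
      exact zero_ne_one h1
    exact ⟨v, (Submodule.eq_of_le_of_finrank_le ((Submodule.span_singleton_le_iff_mem _ _).mpr hv)
      (by rw [h1, finrank_span_singleton hv0])).symm⟩
  choose v hv using hline
  -- the span of the old weight vectors sits inside `span (range v)`, of dimension `≤ g`
  have hW : Submodule.span ℂ {x : U.CohC (U.cmProd F (fun _ : Fin 1 => Θ)) (2 * 1) |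
      ∃ S : Fin 1 → Finset ((F : Type) →+* ℂ), IsHodgeWeight (fun _ : Fin 1 => Θ) 1 S ∧
        U.IsWeightVector F (fun _ : Fin 1 => Θ) S (2 * 1) x} ≤ Submodule.span ℂ (Set.range v) := by
    rw [Submodule.span_le]
    rintro x ⟨S, hS, hx⟩
    obtain ⟨s, hs, rfl⟩ := (isHodgeWeight_one_iff_pair hA Θ S).mp hS
    have hx' : x ∈ U.weightSpace F (fun _ : Fin 1 => Θ) (pairWeight (⟨s, hs⟩ : Θ.1).1) (2 * 1) := hx
    rw [hv] at hx'
    exact Submodule.span_mono (Set.singleton_subset_iff.mpr (Set.mem_range_self (⟨s, hs⟩ : Θ.1))) hx'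
  -- dimension count: `g·g ≤ dim_ℚ B¹ ≤ g`
  have hup : Module.finrank ℚ (U.hodgeClassesOf (U.cmProd F (fun _ : Fin 1 => Θ)) 1) ≤ Fintype.card Θ.1 := by
    have hB : (U.hodgeClassesOf (U.cmProd F (fun _ : Fin 1 => Θ)) 1).baseChange ℂ ≤ Submodule.span ℂ (Set.range v) := by
      refine le_trans ?_ hW
      rw [Submodule.baseChange_eq_span, Submodule.span_le]
      intro x hx
      exact h hx
    have hfr : Module.finrank ℚ (U.hodgeClassesOf (U.cmProd F (fun _ : Fin 1 => Θ)) 1) =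
        Module.finrank ℂ ((U.hodgeClassesOf (U.cmProd F (fun _ : Fin 1 => Θ)) 1).baseChange ℂ) := by
      rw [← (Submodule.toBaseChange.toLinearEquiv ℂ (U.hodgeClassesOf (U.cmProd F (fun _ : Fin 1 => Θ)) 1)).finrank_eq,
        Module.finrank_baseChange]
    rw [hfr]
    exact (Submodule.finrank_mono hB).trans (finrank_range_le_card v)
  have hdown : Fintype.card Θ.1 * Fintype.card Θ.1 ≤ Module.finrank ℚ (U.hodgeClassesOf (U.cmProd F (fun _ : Fin 1 => Θ)) 1) := by
    rw [finrank_hodgeClassesOf_C M hN1 hN2 hN3 hN4 one_pos, ← Nat.card_eq_fintype_card]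
    exact card_mul_card_le_card_isHodgeWeightC Θ hΘ
  have hg : 1 < Fintype.card Θ.1 := by
    obtain ⟨s₁, h₁, s₂, h₂, hne⟩ := h2
    exact Fintype.one_lt_card_iff.mpr ⟨⟨s₁, h₁⟩, ⟨s₂, h₂⟩, fun h => hne (congrArg Subtype.val h)⟩
  nlinarith

/-- Hence the statement of `PohlmannSpan` with its hypotheses on `F` deleted is false as soon as one such `(F, Θ)` exists. -/
theorem not_naivePohlmannSpan_all (M : U.ModelAxioms) (hN1 : U.Fact_cupExterior) (hN2 : U.Fact_cup_hodge)
    (hN3 : U.Fact_pull_H0) (hN4 : U.Fact_hodge_F0) (F : CMField) (hA : AutPair F) (Θ : CMType F) (hΘ : GalStableType Θ)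
    (h2 : ∃ s₁ ∈ Θ.1, ∃ s₂ ∈ Θ.1, s₁ ≠ s₂) :
    ¬ ∀ (F : CMField) (n : ℕ) (Θ : Fin (n + 1) → CMType F) (p : ℕ), U.NaivePohlmannSpanAt F Θ p :=
  fun h => not_naivePohlmannSpanAt M hN1 hN2 hN3 hN4 F hA Θ hΘ h2 (h F 0 _ 1)

end Universe

end HodgeCM

end
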